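import Summits.NavierStokesRegularity.NavierStokesRegularity.Theorems.QuantisedSymmetryPolyhedralTruncationBridge
import Summits.NavierStokesRegularity.NavierStokesRegularity.Theorems.QuantisedSymmetryPolyhedralDssProfileExistsDominatesBlowupProfile
import Summits.NavierStokesRegularity.NavierStokesRegularity.Theorems.DssFarFieldSlavingDssTruncationBridge
import Literature.Analysis.FluidPDE.LocalEnergyWeakNSSolutionOn
import HarnessLib

/-!
# Strategist census companion `s21-g11` — crux `PolyhedralDssProfileExists` (stmt-NavierStokesRegularity-1404)

Kernel-checked bookkeeping for `STRATEGY-CENSUS-s21.md` (planner `cstrat-stmt-NavierStokesRegularity-1404-s21-g11`,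
family `s`, independent census). Nothing here is a new route item; everything is sorry-free.

* §0 `crux_decides` — with `PolyhedralTruncationBridge` and `ClayUniqueness` PROVED in the tree, the crux ALONE
  refutes the summit statement: `PolyhedralDssProfileExists → ¬ NavierStokesRegularity`.
* §1 `crux_imp_w1`, `w1_decides` — the nearest strictly-weaker re-gluable intermediate
  `W₁ = BlowupTypeIDssProfile` (stmt-NavierStokesRegularity-0155, route DssFarFieldSlaving / Blowup) is implied by
  the crux (landed stub `stub_dominatesBlowupProfile`) and is ITSELF summit-deciding (`DssFarFieldSlaving.closes` +
  `dssTruncationBridge_proof`): replacing the crux by `W₁` is not "short of the summit".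
* §2 two typed decompositions with PROVED assemblies, recorded to show where the whole difficulty stays:
  - `D-WEAK`: `WeakPolyhedralDssOrbitExists` (a nonzero λ-DSS ancient LOCAL-ENERGY WEAK solution in the polyhedral
    sector; no mildness, no Type I) ∧ `WeakDssUpgrade` (Liouville-type upgrade: such an orbit is mild with Type-I
    decay) → crux. The existence piece keeps the entire open content (no backward DSS solution of ANY class is known
    to exist — Pineau–Vicol 2026, arXiv:2607.09619 p. 6), and the upgrade piece is a second open statement.
  - `D-NK`: `ApproxCellCertificate` (a Newton–Kantorovich / radii-polynomial certificate about an approximate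
    periodic Leray orbit whose certified zeros are polyhedral profiles) ∧ `NKClosing` (the abstract contraction
    principle, a theorem of functional analysis) → crux. This is the shape of the ONLY complete DSS-existence engine in
    a sibling problem (Reiterer–Trubowitz, arXiv:1203.3766); the certificate piece is the whole crux because no
    numerical candidate exists (corpus + galaxy + tree: none).
-/

set_option linter.dupNamespace false
set_option autoImplicit false

namespace Summit.NavierStokesRegularity.NavierStokesRegularity.Cruxes.PolyhedralDssProfileExists.S21g11

open MeasureTheory
open Summit.NavierStokesRegularity.NavierStokesRegularity

/-- Physical space `ℝ³`. -/
abbrev E3 : Type := EuclideanSpace ℝ (Fin 3)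

/-- The crux, by name. -/
abbrev X : Prop := Theses.QuantisedSymmetry.PolyhedralDssProfileExists

/-! ## §0 The crux alone decides the sub-problem -/

/-- `PolyhedralDssProfileExists → ¬ NavierStokesRegularity`: the route's deciding theorem `closes` with its two other
binders discharged by landed theorems (`quantisedSymmetry_polyhedralTruncationBridge_proof`, `ClayUniqueness_holds`). -/
theorem crux_decides (hX : Theses.QuantisedSymmetry.PolyhedralDssProfileExists) : ¬ _root_.NavierStokesRegularity :=
  Theses.QuantisedSymmetry.closes hX Theorems.quantisedSymmetry_polyhedralTruncationBridge_proof
    Theses.QuantisedSymmetry.ClayUniqueness_holds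

/-! ## §1 The nearest weaker intermediate is itself summit-deciding -/

/-- `X → W₁` with `W₁ = BlowupTypeIDssProfile` (¬ ∀ λ, TypeIDSSLiouville λ ∧ ∀ R, RotatedTypeIDSSLiouville λ R):
the landed stub of line `polyhedral_cell` (lead c15). The two route copies of `W₁` (Blowup / DssFarFieldSlaving)
are the same term. -/
theorem crux_imp_w1 (hX : Theses.QuantisedSymmetry.PolyhedralDssProfileExists) :
    Theses.DssFarFieldSlaving.BlowupTypeIDssProfile :=
  Theorems.PolyhedralDssProfileExists.PolyhedralCell.stub_dominatesBlowupProfile hX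

/-- `W₁` alone refutes the summit: route DssFarFieldSlaving's `closes` with its bridge binder discharged by the landed
`dssTruncationBridge_proof`. Hence `W₁` is not an intermediate "short of the summit". -/
theorem w1_decides (hW : Theses.DssFarFieldSlaving.BlowupTypeIDssProfile) : ¬ _root_.NavierStokesRegularity :=
  Theses.DssFarFieldSlaving.closes Theorems.dssTruncationBridge_proof hW

/-! ## §2a Decomposition D-WEAK (existence in a weak class ∧ regularity upgrade) -/

/-- The symmetry clauses of the crux on `G ≤ O(3)`: finite, inside `SO(3)`, acting irreducibly on `ℝ³`. -/
def IsPolyhedralSector (G : Subgroup (E3 ≃ₗᵢ[ℝ] E3)) : Prop :=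
  Finite G ∧ (∀ g ∈ G, LinearMap.det (g.toLinearEquiv : E3 →ₗ[ℝ] E3) = 1) ∧
    (∀ V : Submodule ℝ E3, (∀ g ∈ G, ∀ v ∈ V, g v ∈ V) → V = ⊥ ∨ V = ⊤)

/-- Piece 1 of D-WEAK: a nonzero `λ`-DSS ancient LOCAL-ENERGY WEAK solution (Robinson–Rodrigo–Sadowski Def. 13.1 class
on the slab `(-∞,0) × ℝ³`, unforced, `ν = 1`) in a polyhedral sector. Strictly weaker than the crux as typed (no mild
identity, no Type-I decay, no slice measurability); no bridge from it to `¬ NavierStokesRegularity` is known. -/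
def WeakPolyhedralDssOrbitExists : Prop :=
  ∃ G : Subgroup (E3 ≃ₗᵢ[ℝ] E3), IsPolyhedralSector G ∧ ∃ c : ℝ, 1 < c ∧ ∃ u : ℝ → E3 → E3,
    Literature.Analysis.FluidPDE.IsLocalEnergyWeakNSSolutionOn (Set.Iio 0) isOpen_Iio 1 0 u ∧
    Literature.Analysis.FluidPDE.IsDiscretelySelfSimilar c u ∧
    (∀ g ∈ G, ∀ t x, u t (g x) = g (u t x)) ∧ ¬ (∀ t < 0, u t =ᵐ[volume] 0)

/-- Piece 2 of D-WEAK: the Liouville-type UPGRADE — every such weak DSS orbit is an ancient mild solution with measurable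
slices and Type-I space–time decay. Open (and possibly false: a DSS weak solution may carry a scale-invariant singular
set), so the split trades one open statement for two. -/
def WeakDssUpgrade : Prop :=
  ∀ G : Subgroup (E3 ≃ₗᵢ[ℝ] E3), IsPolyhedralSector G → ∀ c : ℝ, 1 < c → ∀ u : ℝ → E3 → E3,
    Literature.Analysis.FluidPDE.IsLocalEnergyWeakNSSolutionOn (Set.Iio 0) isOpen_Iio 1 0 u →
    Literature.Analysis.FluidPDE.IsDiscretelySelfSimilar c u →
    (∀ g ∈ G, ∀ t x, u t (g x) = g (u t x)) → ¬ (∀ t < 0, u t =ᵐ[volume] 0) →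
    Literature.Analysis.FluidPDE.IsAncientMildSolution 1 u ∧ (∀ t < 0, AEStronglyMeasurable (u t) volume) ∧
      ∃ C₀ : ℝ, Literature.Analysis.FluidPDE.HasTypeIDecay C₀ u

/-- Assembly of D-WEAK (proved; pure repackaging). -/
theorem x_of_weak_split :
    WeakPolyhedralDssOrbitExists → WeakDssUpgrade → Theses.QuantisedSymmetry.PolyhedralDssProfileExists := by
  rintro ⟨G, hG, c, hc, u, hweak, hdss, hequiv, hne⟩ hup
  obtain ⟨hmild, hmeas, hdecay⟩ := hup G hG c hc u hweak hdss hequiv hne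
  exact ⟨G, hG.1, hG.2.1, hG.2.2, c, hc, u, hmild, hmeas, hdss, hdecay, hequiv, hne⟩

/-! ## §2b Decomposition D-NK (CAP certificate ∧ abstract Newton–Kantorovich closing) -/

/-- Piece 2 of D-NK: the abstract radii-polynomial / Newton–Kantorovich closing principle. `T x = x - A (F x)` maps the
closed ball `B(x₀,r)` into itself and contracts there as soon as `‖A (F x₀)‖ ≤ Y`, `Lip(T|B) ≤ Z < 1` and
`Y + Z r < r`; then `A ∘ F` has a zero in the ball. A THEOREM (Banach fixed point), stated here only to type the split. -/
def NKClosing : Prop :=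
  ∀ (E : Type) [NormedAddCommGroup E] [NormedSpace ℝ E] [CompleteSpace E]
    (F : E → E) (A : E →L[ℝ] E) (x₀ : E) (r Y Z : ℝ),
    0 < r → 0 ≤ Y → 0 ≤ Z → Z < 1 → Y + Z * r < r → ‖A (F x₀)‖ ≤ Y →
    (∀ x ∈ Metric.closedBall x₀ r, ∀ y ∈ Metric.closedBall x₀ r,
        ‖(x - A (F x)) - (y - A (F y))‖ ≤ Z * ‖x - y‖) →
    ∃ x ∈ Metric.closedBall x₀ r, A (F x) = 0

/-- Piece 1 of D-NK: a computer-assisted CERTIFICATE — a Banach space, a zero-finding map `F` (the periodic Leray-orbit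
equation in the polyhedral sector on a Type-I weighted space, after far-field slaving), an injective approximate
inverse `A`, a numerical approximate orbit `x₀` and verified bounds `Y, Z, r` with the radii polynomial negative,
together with the reformulation clause "certified zeros in the ball are polyhedral DSS profiles". This piece carries
the ENTIRE open content of the crux: no numerical candidate `x₀` exists anywhere (corpus, galaxy, tree). -/
def ApproxCellCertificate : Prop :=
  ∃ (E : Type) (_ : NormedAddCommGroup E) (_ : NormedSpace ℝ E) (_ : CompleteSpace E)
    (F : E → E) (A : E →L[ℝ] E) (x₀ : E) (r Y Z : ℝ),
    0 < r ∧ 0 ≤ Y ∧ 0 ≤ Z ∧ Z < 1 ∧ Y + Z * r < r ∧ ‖A (F x₀)‖ ≤ Y ∧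
    (∀ x ∈ Metric.closedBall x₀ r, ∀ y ∈ Metric.closedBall x₀ r,
        ‖(x - A (F x)) - (y - A (F y))‖ ≤ Z * ‖x - y‖) ∧
    (∀ x ∈ Metric.closedBall x₀ r, A (F x) = 0 → X)

/-- Assembly of D-NK (proved; modus ponens through the closing principle). -/
theorem x_of_nk_split :
    ApproxCellCertificate → NKClosing → Theses.QuantisedSymmetry.PolyhedralDssProfileExists := by
  rintro ⟨E, _, _, _, F, A, x₀, r, Y, Z, hr, hY, hZ, hZ1, hrad, hdef, hcontr, hzero⟩ hNK
  obtain ⟨x, hx, hFx⟩ := hNK E F A x₀ r Y Z hr hY hZ hZ1 hrad hdef hcontr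
  exact hzero x hx hFx

end Summit.NavierStokesRegularity.NavierStokesRegularity.Cruxes.PolyhedralDssProfileExists.S21g11
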